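import Summits.AtomisticToContinuum.Crystallization.Theorems.PricedLinkCensusLocalToGlobalFccLattice
import Mathlib.Algebra.Module.ZLattice.Summable

/-!
# The fcc point set as a `ℤ³`-lattice: basis coordinates and the lattice sums `Σ ‖p‖⁻⁶`

Route `PricedLinkCensus`, crux `LocalToGlobal` (stmt-AtomisticToContinuum-14232), line
`flux-cell-joint-census`, support for the registered stub `stub_fccMirrorExact : NewtonShell8 → FccMirrorExact`
(`Theorems/PricedLinkCensusLocalToGlobalDefs`).  The fcc point set `fccSet a = (a/√2)·{n ∈ ℤ³ : Σ nₖ even}` is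
the `ℤ`-span of `b₀ = (a/√2)(1,1,0)`, `b₁ = (a/√2)(1,0,1)`, `b₂ = (a/√2)(0,1,1)`:

* `latVec a j = j₀b₀ + j₁b₁ + j₂b₂ = (a/√2)·(j₀+j₁, j₀+j₂, j₁+j₂)` is an additive bijection `ℤ³ → fcc(a)` (`a ≠ 0`;
  `latVec_injective`, `exists_latVec_eq`), so the lattice sum of the stub statement is a sum over `ℤ³`:
  `Σ'_{p ∈ fcc(a) ∖ 0} ‖p‖⁻⁶ = Σ'_{j ∈ ℤ³} ‖latVec a j‖⁻⁶` (`tsum_fccSet_eq_tsum_latVec`; the `j = 0` term is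
  Lean's `0⁻¹ ^ 6 = 0`);
* finite sets of `ℤ³` lie in boxes `[-K, K]³` (`subset_box`), whence `Σ' ≤ T` as soon as every box sum is `≤ T`
  (`tsum_latVec_le_of_box_le`, no summability needed);
* `fcc(a)` is a full `ℤ`-lattice of `ℝ³` (`latVec a j ∈ span_ℤ` of the real basis `fccBasis a`), so by
  Mathlib's `ZLattice.summable_norm_sub_inv_pow` the shifted sums `Σ_j ‖latVec a j - x‖⁻ⁿ`, `n > 3`, converge
  (`summable_inv_norm_latVec_sub_pow`; registered sub-goal `fccMirror_latticeSum_summable`).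

References: J. H. Conway, N. J. A. Sloane, *Sphere packings, lattices and groups* (1999), Ch. 4 §6.2, §7.1
(`D₃ = A₃ = fcc`, its basis); folklore.
-/

noncomputable section

open scoped BigOperators RealInnerProductSpace Pointwise
open MeasureTheory Metric Set Filter Function Literature.Geometry.DiscreteGeometry

namespace Summit.AtomisticToContinuum.Crystallization.Theorems.PricedLinkCensusLocalToGlobal

/-! ### Basis coordinates on `fcc(a)` -/

/-- The integer coordinates `(j₀+j₁, j₀+j₂, j₁+j₂)` of `j₀(1,1,0) + j₁(1,0,1) + j₂(0,1,1)`. [folklore] -/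
def latCoords (j : Fin 3 → ℤ) : Fin 3 → ℤ := ![j 0 + j 1, j 0 + j 2, j 1 + j 2]

/-- THE fcc POINT WITH BASIS COORDINATES `j`: `latVec a j = (a/√2)·(j₀+j₁, j₀+j₂, j₁+j₂)`. [folklore] -/
def latVec (a : ℝ) (j : Fin 3 → ℤ) : E3 := (a / Real.sqrt 2) • intVec (latCoords j)

/-- `latCoords` is additive. [folklore] -/
theorem latCoords_add (j j' : Fin 3 → ℤ) : latCoords (j + j') = latCoords j + latCoords j' := by
  funext k; fin_cases k <;> simp [latCoords] <;> ring

/-- `latCoords` has even coordinate sum `2(j₀ + j₁ + j₂)`. [folklore] -/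
theorem even_sum_latCoords (j : Fin 3 → ℤ) : Even (∑ k, latCoords j k) :=
  ⟨j 0 + j 1 + j 2, by simp [latCoords, Fin.sum_univ_three]; ring⟩

/-- `latCoords` is injective (`2j₀ = n₀ + n₁ - n₂`, …). [folklore] -/
theorem latCoords_injective : Injective latCoords := fun j j' h => by
  have h0 := congrFun h 0
  have h1 := congrFun h 1
  have h2 := congrFun h 2
  simp only [latCoords, Matrix.cons_val_zero, Matrix.cons_val_one, Matrix.cons_val] at h0 h1 h2
  funext k; fin_cases k <;> simp <;> omega

/-- `latVec a j ∈ fcc(a)`. [folklore] -/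
theorem latVec_mem_fccSet (a : ℝ) (j : Fin 3 → ℤ) : latVec a j ∈ fccSet a :=
  smul_intVec_mem_fccSet a (even_sum_latCoords j)

/-- `latVec a` is additive. [folklore] -/
theorem latVec_add (a : ℝ) (j j' : Fin 3 → ℤ) : latVec a (j + j') = latVec a j + latVec a j' := by
  rw [latVec, latVec, latVec, ← smul_add, latCoords_add]
  congr 1; ext k; simp

/-- `latVec a 0 = 0`. [folklore] -/
@[simp] theorem latVec_zero (a : ℝ) : latVec a 0 = 0 := by
  rw [latVec]
  convert smul_zero (a / Real.sqrt 2)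
  ext k; fin_cases k <;> simp [latCoords]

/-- `latVec a (-j) = -latVec a j`. [folklore] -/
theorem latVec_neg (a : ℝ) (j : Fin 3 → ℤ) : latVec a (-j) = -latVec a j := by
  have h := latVec_add a j (-j)
  rw [add_neg_cancel, latVec_zero] at h
  exact (neg_eq_of_add_eq_zero_right h.symm).symm

/-- `latVec a (j - j') = latVec a j - latVec a j'`. [folklore] -/
theorem latVec_sub (a : ℝ) (j j' : Fin 3 → ℤ) : latVec a (j - j') = latVec a j - latVec a j' := by
  rw [sub_eq_add_neg, latVec_add, latVec_neg, ← sub_eq_add_neg]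

/-- `latVec a` is injective for `a ≠ 0`. [folklore] -/
theorem latVec_injective {a : ℝ} (ha : a ≠ 0) : Injective (latVec a) := by
  have hc : a / Real.sqrt 2 ≠ 0 := div_ne_zero ha (Real.sqrt_ne_zero'.2 two_pos)
  exact ((smul_right_injective E3 hc).comp intVec_injective).comp latCoords_injective

/-- **`latVec a` is onto `fcc(a)`**: an even-sum `n` is `latCoords (r - n₂, r - n₁, r - n₀)`, `2r = Σ nₖ`. [folklore] -/
theorem exists_latVec_eq {a : ℝ} {p : E3} (hp : p ∈ fccSet a) : ∃ j, latVec a j = p := by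
  obtain ⟨n, ⟨r, hr⟩, rfl⟩ := mem_fccSet_iff.1 hp
  refine ⟨![r - n 2, r - n 1, r - n 0], ?_⟩
  rw [latVec]
  congr 1
  rw [Fin.sum_univ_three] at hr
  have hr' : (n 0 : ℝ) + n 1 + n 2 = r + r := by exact_mod_cast hr
  ext k; fin_cases k <;> simp [latCoords] <;> linarith

/-- Distinct basis coordinates give points at distance `≥ a`. [folklore] -/
theorem le_norm_latVec_sub {a : ℝ} (ha : 0 < a) {j j' : Fin 3 → ℤ} (h : j ≠ j') : a ≤ ‖latVec a j - latVec a j'‖ := by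
  rw [← latVec_sub]
  exact le_norm_of_mem_fccSet (latVec_mem_fccSet a _) (fun h0 => h (sub_eq_zero.1 (latVec_injective ha.ne'
    (h0.trans (latVec_zero a).symm))))

/-! ### The lattice sum of the stub statement as a sum over `ℤ³` -/

/-- The bijection `ℤ³ ∖ 0 ≃ fcc(a) ∖ 0` given by `latVec a` (`a ≠ 0`). [folklore] -/
def latVecEquiv {a : ℝ} (ha : a ≠ 0) : {j : Fin 3 → ℤ // j ≠ 0} ≃ {p : E3 // p ∈ fccSet a ∧ p ≠ 0} :=
  Equiv.ofBijective (fun j => ⟨latVec a j.1, latVec_mem_fccSet a j.1, fun h0 => j.2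
      (latVec_injective ha (h0.trans (latVec_zero a).symm))⟩)
    ⟨fun j j' h => Subtype.ext (latVec_injective ha (congrArg Subtype.val h)), fun p => by
      obtain ⟨j, hj⟩ := exists_latVec_eq p.2.1
      refine ⟨⟨j, fun h0 => p.2.2 ?_⟩, Subtype.ext hj⟩
      rw [← hj, h0, latVec_zero]⟩

/-- **`Σ'_{p ∈ fcc(a) ∖ 0} ‖p‖⁻⁶ = Σ'_{j ∈ ℤ³} ‖latVec a j‖⁻⁶`** (`a ≠ 0`; the term `j = 0` vanishes). [folklore] -/
theorem tsum_fccSet_eq_tsum_latVec {a : ℝ} (ha : a ≠ 0) :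
    ∑' p : {p : E3 // p ∈ fccSet a ∧ p ≠ 0}, ‖(p : E3)‖⁻¹ ^ 6 = ∑' j : Fin 3 → ℤ, ‖latVec a j‖⁻¹ ^ 6 := by
  rw [← Equiv.tsum_eq (latVecEquiv ha) (fun p => ‖(p : E3)‖⁻¹ ^ 6)]
  have h := tsum_subtype_eq_of_support_subset (f := fun j : Fin 3 → ℤ => ‖latVec a j‖⁻¹ ^ 6)
    (s := {j | j ≠ 0}) (fun j hj h0 => Function.mem_support.1 hj (by subst h0; simp))
  exact h

/-- The box `[-K, K]³ ⊂ ℤ³`. [folklore] -/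
def box (K : ℕ) : Finset (Fin 3 → ℤ) := Fintype.piFinset fun _ => Finset.Icc (-(K : ℤ)) K

/-- Membership in the box. [folklore] -/
theorem mem_box {K : ℕ} {j : Fin 3 → ℤ} : j ∈ box K ↔ ∀ k, -(K : ℤ) ≤ j k ∧ j k ≤ K := by
  simp [box, Fintype.mem_piFinset]

/-- Every finite subset of `ℤ³` lies in a box. [folklore] -/
theorem subset_box (s : Finset (Fin 3 → ℤ)) : ∃ K : ℕ, s ⊆ box K := by
  refine ⟨s.sup fun j => Finset.univ.sup fun k => (j k).natAbs, fun j hj => mem_box.2 fun k => ?_⟩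
  have h1 : (j k).natAbs ≤ s.sup fun j => Finset.univ.sup fun k => (j k).natAbs :=
    (Finset.le_sup (f := fun k => (j k).natAbs) (Finset.mem_univ k)).trans
      (Finset.le_sup (f := fun j => Finset.univ.sup fun k => (j k).natAbs) hj)
  omega

/-- **Box sums bound the lattice sum**: if `Σ_{j ∈ [-K,K]³} ‖latVec a j‖⁻⁶ ≤ T` for every `K`, then
`Σ'_{p ∈ fcc(a) ∖ 0} ‖p‖⁻⁶ ≤ T` (no summability needed: a divergent `tsum` is `0 ≤ T`). [folklore] -/
theorem tsum_fccSet_le_of_box_le {a : ℝ} (ha : a ≠ 0) {T : ℝ} (hT : 0 ≤ T)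
    (h : ∀ K : ℕ, ∑ j ∈ box K, ‖latVec a j‖⁻¹ ^ 6 ≤ T) :
    ∑' p : {p : E3 // p ∈ fccSet a ∧ p ≠ 0}, ‖(p : E3)‖⁻¹ ^ 6 ≤ T := by
  rw [tsum_fccSet_eq_tsum_latVec ha]
  refine tsum_le_of_sum_le' hT fun s => ?_
  obtain ⟨K, hK⟩ := subset_box s
  exact (Finset.sum_le_sum_of_subset_of_nonneg hK fun j _ _ => by positivity).trans (h K)

/-! ### `fcc(a)` is a full `ℤ`-lattice: summability of the shifted lattice sums -/

/-- The linear map `x ↦ (a/√2)(x₀+x₁, x₀+x₂, x₁+x₂)` of `ℝ³` (columns `b₀, b₁, b₂`). [folklore] -/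
def latLin (a : ℝ) : E3 →ₗ[ℝ] E3 where
  toFun x := (a / Real.sqrt 2) • WithLp.toLp 2 ![x 0 + x 1, x 0 + x 2, x 1 + x 2]
  map_add' x y := by
    rw [← smul_add]; congr 1; ext k; fin_cases k <;> simp <;> ring
  map_smul' c x := by
    rw [RingHom.id_apply, smul_comm]; congr 1; ext k; fin_cases k <;> simp <;> ring

/-- Its inverse `x ↦ (√2/a)((x₀+x₁-x₂)/2, (x₀-x₁+x₂)/2, (-x₀+x₁+x₂)/2)`. [folklore] -/
def latLinInv (a : ℝ) : E3 →ₗ[ℝ] E3 where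
  toFun x := (Real.sqrt 2 / a) • WithLp.toLp 2 ![(x 0 + x 1 - x 2) / 2, (x 0 - x 1 + x 2) / 2, (-x 0 + x 1 + x 2) / 2]
  map_add' x y := by
    rw [← smul_add]; congr 1; ext k; fin_cases k <;> simp <;> ring
  map_smul' c x := by
    rw [RingHom.id_apply, smul_comm]; congr 1; ext k; fin_cases k <;> simp <;> ring

/-- `latLinInv a ∘ latLin a = id` (`a ≠ 0`). [folklore] -/
theorem latLinInv_comp {a : ℝ} (ha : a ≠ 0) : (latLinInv a).comp (latLin a) = LinearMap.id := by
  have h2 : Real.sqrt 2 ≠ 0 := Real.sqrt_ne_zero'.2 two_pos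
  refine LinearMap.ext fun x => ?_
  simp only [LinearMap.comp_apply, LinearMap.id_apply, latLin, latLinInv, LinearMap.coe_mk, AddHom.coe_mk]
  ext k; fin_cases k
  · simp; field_simp; ring
  · simp; field_simp; ring
  · simp; field_simp; ring

/-- `latLin a ∘ latLinInv a = id` (`a ≠ 0`). [folklore] -/
theorem latLin_comp {a : ℝ} (ha : a ≠ 0) : (latLin a).comp (latLinInv a) = LinearMap.id := by
  have h2 : Real.sqrt 2 ≠ 0 := Real.sqrt_ne_zero'.2 two_pos
  refine LinearMap.ext fun x => ?_
  simp only [LinearMap.comp_apply, LinearMap.id_apply, latLin, latLinInv, LinearMap.coe_mk, AddHom.coe_mk]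
  ext k; fin_cases k
  · simp; field_simp; ring
  · simp; field_simp; ring
  · simp; field_simp; ring

/-- The linear automorphism of `ℝ³` with columns `b₀, b₁, b₂` (`a ≠ 0`). [folklore] -/
def latEquiv {a : ℝ} (ha : a ≠ 0) : E3 ≃ₗ[ℝ] E3 :=
  LinearEquiv.ofLinear (latLin a) (latLinInv a) (latLin_comp ha) (latLinInv_comp ha)

/-- `latVec a j` is the image of the integer vector `j`. [folklore] -/
theorem latEquiv_intVec {a : ℝ} (ha : a ≠ 0) (j : Fin 3 → ℤ) : latEquiv ha (intVec j) = latVec a j := by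
  rw [latEquiv, LinearEquiv.ofLinear_apply, latVec]
  simp only [latLin, LinearMap.coe_mk, AddHom.coe_mk]
  congr 1; ext k; fin_cases k <;> simp [latCoords]

/-- THE REAL BASIS `b₀, b₁, b₂` OF `ℝ³` WHOSE `ℤ`-SPAN IS `fcc(a)` (`a ≠ 0`). [folklore] -/
def fccBasis {a : ℝ} (ha : a ≠ 0) : Module.Basis (Fin 3) ℝ E3 :=
  (EuclideanSpace.basisFun (Fin 3) ℝ).toBasis.map (latEquiv ha)

/-- `latVec a j = Σₖ jₖ bₖ` lies in the `ℤ`-span of the basis. [folklore] -/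
theorem latVec_mem_span {a : ℝ} (ha : a ≠ 0) (j : Fin 3 → ℤ) :
    latVec a j ∈ Submodule.span ℤ (Set.range (fccBasis ha)) := by
  have hsum : latVec a j = ∑ k, (j k) • fccBasis ha k := by
    have h1 : intVec j = ∑ k, (j k : ℝ) • (EuclideanSpace.basisFun (Fin 3) ℝ).toBasis k := by
      conv_lhs => rw [← (EuclideanSpace.basisFun (Fin 3) ℝ).toBasis.sum_repr (intVec j)]
      refine Finset.sum_congr rfl fun k _ => ?_
      simp
    rw [← latEquiv_intVec ha, h1, map_sum]
    refine Finset.sum_congr rfl fun k _ => ?_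
    rw [map_smul, fccBasis, Module.Basis.map_apply, Int.cast_smul_eq_zsmul]
  rw [hsum]
  exact Submodule.sum_mem _ fun k _ => Submodule.smul_mem _ _ (Submodule.subset_span (Set.mem_range_self k))

/-- **Summability of the shifted lattice sums**: `Σ_j ‖latVec a j - x‖⁻ⁿ` converges for `n > 3`, `a ≠ 0`
(`p`-series on the rank-3 lattice `fcc(a)`). [folklore] -/
theorem summable_inv_norm_latVec_sub_pow {a : ℝ} (ha : a ≠ 0) {n : ℕ} (hn : 3 < n) (x : E3) :
    Summable fun j : Fin 3 → ℤ => ‖latVec a j - x‖⁻¹ ^ n := by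
  have hrank : Module.finrank ℤ (Submodule.span ℤ (Set.range (fccBasis ha))) = 3 := by
    rw [ZLattice.rank ℝ (Submodule.span ℤ (Set.range (fccBasis ha))), finrank_euclideanSpace_fin]
  have hs := ZLattice.summable_norm_sub_inv_pow (Submodule.span ℤ (Set.range (fccBasis ha))) n
    (by rw [hrank]; exact hn) x
  have hinj : Injective (fun j : Fin 3 → ℤ =>
      (⟨latVec a j, latVec_mem_span ha j⟩ : Submodule.span ℤ (Set.range (fccBasis ha)))) :=
    fun j j' h => latVec_injective ha (congrArg Subtype.val h)
  have h := hs.comp_injective hinj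
  refine h.congr fun j => ?_
  simp only [Function.comp_apply]

/-- **Registered sub-goal `fccMirror_latticeSum_summable`** (line `flux-cell-joint-census`, support of
`stub_fccMirrorExact`): the shifted inverse-power sums over `fcc(a)` in basis coordinates converge for exponents
`n > 3`, binder form of `summable_inv_norm_latVec_sub_pow`. [folklore] -/
theorem fccMirror_latticeSum_summable : ∀ (a : ℝ), a ≠ 0 → ∀ (n : ℕ), 3 < n → ∀ x : E3,
    Summable fun j : Fin 3 → ℤ => ‖latVec a j - x‖⁻¹ ^ n :=
  fun _ ha _ hn x => summable_inv_norm_latVec_sub_pow ha hn x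

end Summit.AtomisticToContinuum.Crystallization.Theorems.PricedLinkCensusLocalToGlobal

end
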